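import Literature.Analysis.FluidPDE.LocalTypeI
import Literature.Analysis.FluidPDE.SuitableWeakProofs
import HarnessLib

/-!
# Route `AxisTwistDoor`, crux `AveragedConeLiouville` (stmt-NavierStokesRegularity-26889) — INPUT N3 (`ShellFact` by the
# compactness–contradiction route), piece S5 part 1: THE SLAB-REGULAR SET AND THE RAISED-VERTEX COVER (geometry only)

N3 cut of record (pub/ns-inputs STATUS 2026-08-28T12:41:44Z, texts `kits/N3-skeleton.lean` 815f0a7c119d2985).  Tools for the assembly
`stub_shellFact_of_atoms` (part 2, `…ShellFactOfAtoms`): for a field `u` on the backward slab, the SLAB-REGULAR set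
`G(u) = {w : u is essentially bounded on Q*_ρ(w) ∩ {t < 0} for some ρ > 0}` is OPEN (`isOpen_slabRegular`); a point off `G(u)` is
not a regular point (`not_isRegularPoint_of_not_slabRegular`) and, on the lid `t = 0`, is backward-singular
(`isBackwardSingularPoint_of_not_slabRegular`), so `{t ≤ 0} ∖ G(u) ⊆ singularSet u ({t<0}) ∪ lid-singular set`
(`diff_slabRegular_subset`); RAISED VERTICES: for `w ∈ G(u)` with `t_w ≤ 0` and radius `ρ`, the backward cylinder with vertex
`z̄_w = (min(t_w + ρ²/32, 0), x_w)` and radius `ρ/2` lies in `Q*_ρ(w) ∩ {t<0}` (`cylinder_raised_subset`), and the OPEN box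
`O_w = ]z̄_w.1 − ρ²/16, t_w + ρ²/32[ × B(x_w, ρ/4) ∋ w` meets the slab inside `Q(z̄_w, ρ/4)` (`mem_box`, `box_inter_slab_subset`) —
backward cylinders do not contain their vertex, the raised vertex repairs this (cut note n1); finally the small cylinders
`Q(ζ⁺, R′)`, `ζ⁺ = (min(t + R′²/8, 0), x)`, sit inside the sup-metric ball `B(ζ, λ)` for `R′ ≤ min(λ/2, 1/8)`, `λ ≤ 1`, and contain
`ζ` at half radius (`smallCylinder_subset_ball`, `mem_smallCylinder_half`).

Pure geometry / measure theory; no NS statement is proved; N3 is an INPUT toward `ShellFact`; item 26889 and the summit stay OPEN.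
`--supports stmt-NavierStokesRegularity-26889 --as helper`. [folklore]
-/

noncomputable section

-- the summit and its single sub-problem share the name (CONVENTIONS §1)
set_option linter.dupNamespace false

open MeasureTheory Set Function Metric Filter Topology
open scoped NNReal ENNReal

namespace Summit.NavierStokesRegularity.NavierStokesRegularity.Theorems.AveragedConeLiouville.Shell

open Literature.Analysis Literature.Analysis.FluidPDE

variable {u : ℝ → EuclideanSpace ℝ (Fin 3) → EuclideanSpace ℝ (Fin 3)}

/-! ### The slab-regular set -/

/-- **The slab-regular set is open**: if `u` is essentially bounded by `M` on `Q*_ρ(w) ∩ {t<0}`, then for `w'` within sup-distance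
`min(ρ/2, ρ²/2)` of `w`, `Q*_{ρ/2}(w') ⊆ Q*_ρ(w)`, so `w'` is slab-regular with the same bound. [folklore] -/
theorem isOpen_slabRegular (u : ℝ → EuclideanSpace ℝ (Fin 3) → EuclideanSpace ℝ (Fin 3)) :
    IsOpen {w : ℝ × EuclideanSpace ℝ (Fin 3) | ∃ ρ : ℝ, 0 < ρ ∧ ∃ M : ℝ,
      ∀ᵐ q ∂(volume.restrict (parabolicCylinderCentered ρ w ∩ (Iio (0 : ℝ) ×ˢ (univ : Set (EuclideanSpace ℝ (Fin 3)))))),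
        ‖u q.1 q.2‖ ≤ M} := by
  rw [Metric.isOpen_iff]
  rintro w ⟨ρ, hρ, M, hM⟩
  refine ⟨min (ρ / 2) (ρ ^ 2 / 2), lt_min (by positivity) (by positivity), fun w' hw' => ?_⟩
  rw [mem_ball, Prod.dist_eq, max_lt_iff] at hw'
  obtain ⟨h1, h2⟩ := hw'
  rw [Real.dist_eq] at h1
  have h1' : |w'.1 - w.1| < ρ ^ 2 / 2 := lt_of_lt_of_le h1 (min_le_right _ _)
  have h2' : dist w'.2 w.2 < ρ / 2 := lt_of_lt_of_le h2 (min_le_left _ _)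
  refine ⟨ρ / 2, by positivity, M, ae_restrict_of_ae_restrict_of_subset (inter_subset_inter_left _ ?_) hM⟩
  rintro q ⟨⟨hq1, hq2⟩, hq3⟩
  rw [abs_lt] at h1'
  refine ⟨⟨by nlinarith, by nlinarith⟩, ?_⟩
  rw [mem_ball] at hq3 ⊢
  linarith [dist_triangle q.2 w'.2 w.2]

/-- A point off the slab-regular set is not a regular point (`Q*_r(w) ∩ {t<0} ⊆ Q*_r(w)`). [folklore] -/
theorem not_isRegularPoint_of_not_slabRegular {w : ℝ × EuclideanSpace ℝ (Fin 3)}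
    (hw : w ∉ {w : ℝ × EuclideanSpace ℝ (Fin 3) | ∃ ρ : ℝ, 0 < ρ ∧ ∃ M : ℝ,
      ∀ᵐ q ∂(volume.restrict (parabolicCylinderCentered ρ w ∩ (Iio (0 : ℝ) ×ˢ (univ : Set (EuclideanSpace ℝ (Fin 3)))))),
        ‖u q.1 q.2‖ ≤ M}) :
    ¬ IsRegularPoint u w := by
  rintro ⟨r, hr, hfin⟩
  refine hw ⟨r, hr, (eLpNorm (uncurry u) ∞ (volume.restrict (parabolicCylinderCentered r w))).toReal, ?_⟩
  have h1 : ∀ᵐ q ∂(volume.restrict (parabolicCylinderCentered r w)), ‖u q.1 q.2‖ ≤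
      (eLpNorm (uncurry u) ∞ (volume.restrict (parabolicCylinderCentered r w))).toReal := by
    have hne : eLpNormEssSup (uncurry u) (volume.restrict (parabolicCylinderCentered r w)) ≠ ⊤ := by
      rw [← eLpNorm_exponent_top]; exact hfin.ne
    have h := ae_le_eLpNormEssSup (f := uncurry u) (μ := volume.restrict (parabolicCylinderCentered r w))
    filter_upwards [h] with q hq
    rw [eLpNorm_exponent_top]
    have h2 := ENNReal.toReal_mono hne hq
    rw [toReal_enorm] at h2
    exact h2
  exact ae_restrict_of_ae_restrict_of_subset inter_subset_left h1


/-- A lid point (`t = 0`) off the slab-regular set is backward-singular: `Q*_ρ((0,x)) ∩ {t<0} = Q((0,x),ρ)`. [folklore] -/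
theorem isBackwardSingularPoint_of_not_slabRegular {w : ℝ × EuclideanSpace ℝ (Fin 3)}
    (hw : w ∉ {w : ℝ × EuclideanSpace ℝ (Fin 3) | ∃ ρ : ℝ, 0 < ρ ∧ ∃ M : ℝ,
      ∀ᵐ q ∂(volume.restrict (parabolicCylinderCentered ρ w ∩ (Iio (0 : ℝ) ×ˢ (univ : Set (EuclideanSpace ℝ (Fin 3)))))),
        ‖u q.1 q.2‖ ≤ M})
    (h0 : w.1 = 0) : IsBackwardSingularPoint u w := by
  intro r hr
  by_contra hfin
  have hfin' : eLpNorm (uncurry u) ∞ (volume.restrict (parabolicCylinder r w)) < ∞ := lt_top_iff_ne_top.2 hfin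
  refine hw ⟨r, hr, (eLpNorm (uncurry u) ∞ (volume.restrict (parabolicCylinder r w))).toReal, ?_⟩
  have hsub : parabolicCylinderCentered r w ∩ (Iio (0 : ℝ) ×ˢ (univ : Set (EuclideanSpace ℝ (Fin 3)))) ⊆
      parabolicCylinder r w := by
    rintro q ⟨⟨hq1, hq2⟩, hq3, -⟩
    refine ⟨⟨hq1.1, ?_⟩, hq2⟩
    rw [h0]; exact hq3
  have h1 : ∀ᵐ q ∂(volume.restrict (parabolicCylinder r w)), ‖u q.1 q.2‖ ≤
      (eLpNorm (uncurry u) ∞ (volume.restrict (parabolicCylinder r w))).toReal := by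
    have hne : eLpNormEssSup (uncurry u) (volume.restrict (parabolicCylinder r w)) ≠ ⊤ := by
      rw [← eLpNorm_exponent_top]; exact hfin
    have h := ae_le_eLpNormEssSup (f := uncurry u) (μ := volume.restrict (parabolicCylinder r w))
    filter_upwards [h] with q hq
    rw [eLpNorm_exponent_top]
    have h2 := ENNReal.toReal_mono hne hq
    rw [toReal_enorm] at h2
    exact h2
  exact ae_restrict_of_ae_restrict_of_subset hsub h1

/-- **Off the slab-regular set, points of the closed lower half-space are interior singular points or backward-singular lid points.**
[folklore] -/
theorem diff_slabRegular_subset {K : Set (ℝ × EuclideanSpace ℝ (Fin 3))} (hK : ∀ w ∈ K, w.1 ≤ 0) :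
    K \ {w : ℝ × EuclideanSpace ℝ (Fin 3) | ∃ ρ : ℝ, 0 < ρ ∧ ∃ M : ℝ,
      ∀ᵐ q ∂(volume.restrict (parabolicCylinderCentered ρ w ∩ (Iio (0 : ℝ) ×ˢ (univ : Set (EuclideanSpace ℝ (Fin 3)))))),
        ‖u q.1 q.2‖ ≤ M} ⊆
      singularSet u (Iio (0 : ℝ) ×ˢ (univ : Set (EuclideanSpace ℝ (Fin 3)))) ∪
        {z : ℝ × EuclideanSpace ℝ (Fin 3) | z.1 = 0 ∧ IsBackwardSingularPoint u z} := by
  rintro w ⟨hwK, hwG⟩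
  rcases (hK w hwK).lt_or_eq with hlt | heq
  · exact Or.inl ⟨⟨hlt, mem_univ _⟩, not_isRegularPoint_of_not_slabRegular hwG⟩
  · exact Or.inr ⟨heq, isBackwardSingularPoint_of_not_slabRegular hwG heq⟩

/-! ### Raised vertices -/

/-- **The raised backward cylinder lies in the cut centred cylinder**: for `t_w ≤ 0`, `ρ > 0`, with
`τ = min(t_w + ρ²/32, 0)`: `Q((τ, x_w), ρ/2) ⊆ Q*_ρ(w) ∩ {t<0}`. [folklore] -/
theorem cylinder_raised_subset {w : ℝ × EuclideanSpace ℝ (Fin 3)} {ρ : ℝ} (hw : w.1 ≤ 0) (hρ : 0 < ρ) :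
    parabolicCylinder (ρ / 2) ((min (w.1 + ρ ^ 2 / 32) 0, w.2) : ℝ × EuclideanSpace ℝ (Fin 3)) ⊆
      parabolicCylinderCentered ρ w ∩ (Iio (0 : ℝ) ×ˢ (univ : Set (EuclideanSpace ℝ (Fin 3)))) := by
  rintro q ⟨⟨hq1, hq2⟩, hq3⟩
  simp only at hq1 hq2 hq3
  have hmin0 : min (w.1 + ρ ^ 2 / 32) 0 ≤ 0 := min_le_right _ _
  have hmin1 : min (w.1 + ρ ^ 2 / 32) 0 ≤ w.1 + ρ ^ 2 / 32 := min_le_left _ _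
  have hmin2 : w.1 ≤ min (w.1 + ρ ^ 2 / 32) 0 := le_min (by nlinarith) hw
  refine ⟨⟨⟨by nlinarith, by nlinarith⟩, ball_subset_ball (by linarith) hq3⟩, ⟨lt_of_lt_of_le hq2 hmin0, mem_univ _⟩⟩

/-- **The open box around `w` contains `w`.** [folklore] -/
theorem mem_box {w : ℝ × EuclideanSpace ℝ (Fin 3)} {ρ : ℝ} (hρ : 0 < ρ) :
    w ∈ Ioo (min (w.1 + ρ ^ 2 / 32) 0 - ρ ^ 2 / 16) (w.1 + ρ ^ 2 / 32) ×ˢ ball w.2 (ρ / 4) := by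
  have hmin1 : min (w.1 + ρ ^ 2 / 32) 0 ≤ w.1 + ρ ^ 2 / 32 := min_le_left _ _
  exact ⟨⟨by nlinarith, by nlinarith⟩, mem_ball_self (by positivity)⟩

/-- **The open box meets the slab inside the halved raised cylinder `Q(z̄_w, ρ/4)`.** [folklore] -/
theorem box_inter_slab_subset (w : ℝ × EuclideanSpace ℝ (Fin 3)) (ρ : ℝ) :
    (Ioo (min (w.1 + ρ ^ 2 / 32) 0 - ρ ^ 2 / 16) (w.1 + ρ ^ 2 / 32) ×ˢ ball w.2 (ρ / 4)) ∩
        (Iio (0 : ℝ) ×ˢ (univ : Set (EuclideanSpace ℝ (Fin 3)))) ⊆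
      parabolicCylinder (ρ / 2 / 2) ((min (w.1 + ρ ^ 2 / 32) 0, w.2) : ℝ × EuclideanSpace ℝ (Fin 3)) := by
  rintro q ⟨⟨⟨hq1, hq2⟩, hq3⟩, hq4, -⟩
  refine ⟨⟨?_, ?_⟩, ?_⟩
  · simp only; nlinarith
  · simp only; exact lt_min hq2 hq4
  · simp only; rw [show ρ / 2 / 2 = ρ / 4 by ring]; exact hq3

/-! ### Small cylinders near a point of the open slab -/

/-- **A small backward cylinder with raised vertex lies in the sup-metric ball**: for `λ ≤ 1`, `0 < R' ≤ λ/2`, `t < 0`,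
`Q((min(t + R'²/8, 0), x), R') ⊆ B((t,x), λ)` (`t ≤ 0`). [folklore] -/
theorem smallCylinder_subset_ball {ζ : ℝ × EuclideanSpace ℝ (Fin 3)} {R' lam : ℝ} (hR' : 0 < R') (hR'lam : R' ≤ lam / 2)
    (hlam : lam ≤ 1) (hζ : ζ.1 ≤ 0) :
    parabolicCylinder R' ((min (ζ.1 + R' ^ 2 / 8) 0, ζ.2) : ℝ × EuclideanSpace ℝ (Fin 3)) ⊆ ball ζ lam := by
  rintro q ⟨⟨hq1, hq2⟩, hq3⟩
  simp only at hq1 hq2 hq3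
  have hmin1 : min (ζ.1 + R' ^ 2 / 8) 0 ≤ ζ.1 + R' ^ 2 / 8 := min_le_left _ _
  have hlam0 : 0 < lam := by linarith
  have hR'sq : R' ^ 2 ≤ lam / 4 := by nlinarith
  rw [mem_ball, Prod.dist_eq, max_lt_iff]
  refine ⟨?_, by rw [mem_ball] at hq3; linarith⟩
  rw [Real.dist_eq, abs_lt]
  constructor
  · -- `q.1 > ζ.1 - λ`: `q.1 > τ - R'^2 ≥ ζ.1 - R'^2` only if `τ ≥ ζ.1`... use `τ ≥ min(ζ.1 + R'^2/8, 0)` and both cases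
    rcases le_or_gt (ζ.1 + R' ^ 2 / 8) 0 with h | h
    · rw [min_eq_left h] at hq1; nlinarith
    · rw [min_eq_right h.le] at hq1; nlinarith
  · nlinarith

/-- **The point itself lies in the half-radius small cylinder** (`t < 0`). [folklore] -/
theorem mem_smallCylinder_half {ζ : ℝ × EuclideanSpace ℝ (Fin 3)} {R' : ℝ} (hR' : 0 < R') (hζ : ζ.1 < 0) :
    ζ ∈ parabolicCylinder (R' / 2) ((min (ζ.1 + R' ^ 2 / 8) 0, ζ.2) : ℝ × EuclideanSpace ℝ (Fin 3)) := by
  refine ⟨⟨?_, ?_⟩, mem_ball_self (by positivity)⟩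
  · simp only
    rcases le_or_gt (ζ.1 + R' ^ 2 / 8) 0 with h | h
    · rw [min_eq_left h]; nlinarith
    · rw [min_eq_right h.le]; nlinarith
  · simp only
    exact lt_min (by nlinarith) hζ

/-- The raised vertex time is nonpositive. [folklore] -/
theorem min_add_le_zero (t c : ℝ) : min (t + c) 0 ≤ 0 := min_le_right _ _

end Summit.NavierStokesRegularity.NavierStokesRegularity.Theorems.AveragedConeLiouville.Shell

end
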